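import Mathlib
import HarnessLib
import Summits.HubbardSuperconductivity.HubbardSuperconductivity.Theorems.KLProgrammeKLRegimeCountertermMultiSlotSelfMap
import Summits.HubbardSuperconductivity.HubbardSuperconductivity.Theorems.KLProgrammeKLRegimeCountertermV11Volume
import Summits.HubbardSuperconductivity.HubbardSuperconductivity.Theorems.KLProgrammeKLRegimeCountertermMajorantSums
import Summits.HubbardSuperconductivity.HubbardSuperconductivity.Theorems.KLProgrammeKLRegimeCountertermPicardReading

/-!
# Route `KLProgramme` — child `KLRegimeCounterterm` (gen 3, `CountertermP2 klPredsV11 klWindowC`; gen-2 item stmt-HubbardSuperconductivity-19664):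
# THE WHOLESALE CONTINUATION AT ONE VOLUME — «fixed point on FrameOK's tube, contraction in the frame norm»
# (seat hubbard-kl-k3c3-p2)

At a fixed volume `(L, M)` carrying child 2's hypothesis block (the V11 slots for every admissible frame renormalised below the scale),
the frame is built by ONE Picard step per scale of the wholesale counterterm map
`Φ_n(K) := P^G(K) ⊖ D_n^G(K)` (`= −Σ_{i≤n} ℓ_i^G(K)` pointwise): `K_0 := Φ_0(0)`, `K_{n+1} := Φ_{n+1}(K_n)`, `K := K_N`, `N = nScales β`.
Bookkeeping quantity: the PARTIAL SUMS `S_j(K)(q) := K(q) + Σ_{i≤j} ℓ_i^G(K)(q)` (`S_n(K) = K − Φ_n(K)`).  One step at level `n` from a frame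
`K` (admissible, renormalised below `n`, `sup|S_n(K)| ≤ δ`) produces `K' = Φ_n(K)` with
`S_j(K') = Σ_{i≤j} (ℓ_i(K') − ℓ_i(K)) − Σ_{j<i≤n} ℓ_i(K)`, hence `sup|S_j(K')| ≤ q·δ + T̄_{j,n}` by (E3c) (`q = Σ lipBar ≤ (4/3)(SL+SL′|U|)|U|`,
`frameDist(K, K′) = sup|S_n(K)| ≤ δ`) and the tails (E3a, `j = 0`); `K'` is ADMISSIBLE by `frameOK_of_multiSlot'` ((E3a-MS), Δ20) and
RENORMALISED at every `j ≤ n` by the READING hypothesis (`|ν_j(K′)(θ)| ≤ sup|S_j(K′)| + wig j`, k3c3-p1's `…CountertermReading` /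
k3c3-p3's wiggle, Δ18) — in this order, by strong induction on `j`, because (E3c)'s comparison frame must carry the history below the scale.
Since `q = O(U)`, one step per level suffices (`δ_n ≤ 2·twoLegBar 0 n` throughout), and the final frame has
`|ν_j(K)(θ)| ≤ T̄_{j,N} + 2q·twoLegBar 0 N + wig j ≤ ½·ctCr·|U|·Λ_j²/e₀` (`ctCr = 5S₀+1`: `64(S₀+S₀′U)(1/15 + 2q) + 64·(wig slack) ≤ 5S₀+1`).

Inputs, all as HYPOTHESES of the theorems (no definition, nothing asserted about the model):
* `blk` — the V11 block AT THIS VOLUME for a package `R` with `R.cr = ctCr G` (`CtHypMsV11 …` specialised to `(L, M)`: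
  `ctBlockAt_of_ctHypMsV11`; any `R` with the ROOM `2(S j + S′ j|U|) ≤ Gfr j`, `Σ msBar ≤ ½` works — p2's `ctRenMs_thresholds`);
* `hread` — the READING inequality with slack `wig : ℕ → ℝ` (discharged from (E3g) + the wiggle + frame geometry by the reading modules;
  here abstract), and `hwig : wig n ≤ |U|·16^{-n}/256`;
* the numeric side conditions on `U` (room for the fine parts, contraction `q ≤ 1/1000`, `Q.S′ 0·|U| ≤ 1/10`) and the three order-`≤ 2`
  allowance sums of `R` (the `c₁ / U₀` conditions).
Main results: `ct_step` (one Picard step), `ct_levelUp`, `ct_exists_post` (the induction over levels), **`ct_oneVolume_of_reading`** (an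
admissible frame renormalised to HALF tolerance at every scale and every angle, at this volume).
-/

noncomputable section

namespace Summit.HubbardSuperconductivity.HubbardSuperconductivity.Theorems.KLRegimeSplit

set_option linter.dupNamespace false -- summit = problem name (single-conjunct summit), D-0017

open Real Finset
open Literature.MathematicalPhysics.QuantumLattice Literature.Probability.LatticeModels
open Summit.HubbardSuperconductivity.HubbardSuperconductivity.Theorems.KLProgrammeLegKernels

/-! ## §2 The partial sums `S_n(K) = K − Φ_n(K)` and the block at one volume -/

section Model

variable {L M : ℕ} [NeZero L] [NeZero M]

/-- **`S_n(K)(q) = K(q) − Φ_n(K)(q)`**: the partial sum of the pieces is the displacement of the wholesale map (telescoping). -/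
theorem partialSum_eq_sub_counterIter (β U μ : ℝ) (K : TrigPolyC4v) (n : ℕ) (q : Fin 2 → ℝ) :
    K.eval q + ∑ i ∈ range (n + 1), (klTwoLegPieceG L M β U μ K i).eval q =
      K.eval q - (fsub (klFrameProjG L μ K) (klTwoLegPolyG L M β U μ K n)).eval q := by
  rw [eval_fsub, sum_eval_klTwoLegPieceG]; ring

variable {G : GeoConsts} {P : SplitConsts} {Q : EngConsts} {β U μ : ℝ}

/-- The V11 hypothesis block (package `ctRenMs G`, the registered stub's) specialised to one volume `(L, M)` beyond the thresholds. -/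
theorem ctBlockAt_of_ctHypMsV11 {Lh : ℕ} {Mh : ℕ → ℕ} (hyp : CtHypMsV11 G P Q β U μ Lh Mh) (hL : Lh ≤ L) (hM : Mh L ≤ M) :
    ∀ K : TrigPolyC4v, FrameOK (ctRenMs G) U (nScales β) μ K → ∀ n : ℕ, n ≤ nScales β →
      (∀ j < n, RenormalisedAtF L M β U μ K (ctRenMs G) j) →
        EngineBoundsAtV7S L M G P Q β U μ K n ∧ TwoLegStepV11 L M G P Q (ctRenMs G) β U μ K n ∧
          BetaSplitAtS2 L M G P Q β U μ K n :=
  fun K hK n hn hren => hyp K hK L M hL hM n hn hren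

/-- From the block: the scale-`i` piece of a frame renormalised below `i` is bounded by `twoLegBar 0 i` everywhere ((E3a) tier 1, `j = 0`). -/
theorem abs_eval_piece_le_of_block {R : RenConsts}
    (blk : ∀ K : TrigPolyC4v, FrameOK R U (nScales β) μ K → ∀ n : ℕ, n ≤ nScales β →
      (∀ j < n, RenormalisedAtF L M β U μ K R j) →
        EngineBoundsAtV7S L M G P Q β U μ K n ∧ TwoLegStepV11 L M G P Q R β U μ K n ∧ BetaSplitAtS2 L M G P Q β U μ K n)
    {K : TrigPolyC4v} (hK : FrameOK R U (nScales β) μ K) {i : ℕ} (hi : i ≤ nScales β)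
    (hren : ∀ j < i, RenormalisedAtF L M β U μ K R j) (p : Fin 2 → ℝ) :
    |(klTwoLegPieceG L M β U μ K i).eval p| ≤ twoLegBar G Q U 0 i := by
  have h := ((blk K hK i hi hren).2.1.1).1.1 0 (by norm_num) (WithLp.toLp 2 p)
  rw [norm_iteratedFDeriv_zero, Real.norm_eq_abs] at h
  simpa [evalM] using h

end Model

/-! ## §3 One Picard step -/

section Step

variable {L M : ℕ} [NeZero L] [NeZero M] {G : GeoConsts} {P : SplitConsts} {Q : EngConsts} {β U μ : ℝ} {R : RenConsts}
  (wig : ℕ → ℝ)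

/-- **Self-map at this volume**: for an admissible frame renormalised below `n ≤ N`, `Φ_n(K)` is admissible (Δ20: `frameOK_of_multiSlot'` fed
by the block's (E3a-MS) at the scales `i ≤ n`). -/
theorem ct_frameOK_counterIter (hG : G.WF) (hQ : Q.WF) (hμ : μ ∈ klWindowC) (hR : ∀ j, 0 ≤ R.Gfr j)
    (blk : ∀ K : TrigPolyC4v, FrameOK R U (nScales β) μ K → ∀ n : ℕ, n ≤ nScales β →
      (∀ j < n, RenormalisedAtF L M β U μ K R j) →
        EngineBoundsAtV7S L M G P Q β U μ K n ∧ TwoLegStepV11 L M G P Q R β U μ K n ∧ BetaSplitAtS2 L M G P Q β U μ K n)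
    (hroomA : ∀ j ≤ 4, 2 * (G.S j + Q.S' j * |U|) ≤ R.Gfr j) (hroomB : ∀ n : ℕ, ∑ i ∈ range (n + 1), msBar G Q U i ≤ 1 / 2)
    (h0 : ∑ m ∈ range (nScales β + 1), R.Gfr 0 * uPow 0 U * (4 : ℝ) ^ (((0 : ℤ) - 2) * m) ≤ 3 / 80)
    (h1 : ∑ m ∈ range (nScales β + 1), R.Gfr 1 * uPow 1 U * (4 : ℝ) ^ (((1 : ℤ) - 2) * m) ≤ 1 / 2000)
    (h2 : ∑ m ∈ range (nScales β + 1), ∑ j ∈ range 3, R.Gfr j * uPow j U * (4 : ℝ) ^ (((j : ℤ) - 2) * m) ≤ 1 / 100) {K : TrigPolyC4v} (hK : FrameOK R U (nScales β) μ K) {n : ℕ} (hn : n ≤ nScales β)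
    (hren : ∀ j < n, RenormalisedAtF L M β U μ K R j) :
    FrameOK R U (nScales β) μ (fsub (klFrameProjG L μ K) (klTwoLegPolyG L M β U μ K n)) := by
  refine frameOK_of_multiSlot (L := L) (M := M) hG hQ hR hn hμ (fun i hi => ?_) hroomA (hroomB n) h0 h1 h2
  exact (blk K hK i (hi.trans hn) fun j hj => hren j (lt_of_lt_of_le hj hi)).2.1.2.1

/-- **ONE PICARD STEP at level `n`.**  From an admissible `K` renormalised below `n` with `sup|S_n(K)| ≤ δ`, and the feasibility
`T̄_{j,n} + q·δ + wig j ≤ tol_j` (`j ≤ n`): `K′ = Φ_n(K)` is admissible, renormalised at every `j ≤ n`, and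
`sup|S_j(K′)| ≤ T̄_{j,n} + q·δ` (`q = (4/3)(SL + SL′|U|)|U|`, `T̄_{j,n} = Σ_{i∈Ico (j+1)(n+1)} twoLegBar 0 i`). -/
theorem ct_step (hG : G.WF) (hQ : Q.WF) (hμ : μ ∈ klWindowC) (hR : ∀ j, 0 ≤ R.Gfr j) (hcr : R.cr = ctCr G)
    (blk : ∀ K : TrigPolyC4v, FrameOK R U (nScales β) μ K → ∀ n : ℕ, n ≤ nScales β →
      (∀ j < n, RenormalisedAtF L M β U μ K R j) →
        EngineBoundsAtV7S L M G P Q β U μ K n ∧ TwoLegStepV11 L M G P Q R β U μ K n ∧ BetaSplitAtS2 L M G P Q β U μ K n)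
    (hread : ∀ K : TrigPolyC4v, FrameOK R U (nScales β) μ K → ∀ n : ℕ, n ≤ nScales β →
      (∀ j < n, RenormalisedAtF L M β U μ K R j) → ∀ B : ℝ,
        (∀ q : Fin 2 → ℝ, |K.eval q + ∑ i ∈ range (n + 1), (klTwoLegPieceG L M β U μ K i).eval q| ≤ B) →
          ∀ θ : ℝ, |klLocalPart L M β U μ K n θ| ≤ B + wig n)
    (hroomA : ∀ j ≤ 4, 2 * (G.S j + Q.S' j * |U|) ≤ R.Gfr j) (hroomB : ∀ n : ℕ, ∑ i ∈ range (n + 1), msBar G Q U i ≤ 1 / 2)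
    (h0 : ∑ m ∈ range (nScales β + 1), R.Gfr 0 * uPow 0 U * (4 : ℝ) ^ (((0 : ℤ) - 2) * m) ≤ 3 / 80)
    (h1 : ∑ m ∈ range (nScales β + 1), R.Gfr 1 * uPow 1 U * (4 : ℝ) ^ (((1 : ℤ) - 2) * m) ≤ 1 / 2000)
    (h2 : ∑ m ∈ range (nScales β + 1), ∑ j ∈ range 3, R.Gfr j * uPow j U * (4 : ℝ) ^ (((j : ℤ) - 2) * m) ≤ 1 / 100) {K : TrigPolyC4v} (hK : FrameOK R U (nScales β) μ K) {n : ℕ} (hn : n ≤ nScales β)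
    (hren : ∀ j < n, RenormalisedAtF L M β U μ K R j) {δ : ℝ} (hδ0 : 0 ≤ δ)
    (hδ : ∀ q : Fin 2 → ℝ, |K.eval q + ∑ i ∈ range (n + 1), (klTwoLegPieceG L M β U μ K i).eval q| ≤ δ)
    (hfeas : ∀ j ≤ n, ∑ i ∈ Ico (j + 1) (n + 1), twoLegBar G Q U 0 i + 4 / 3 * (G.SL + Q.SL * |U|) * |U| * δ + wig j ≤
      ctCr G * |U| * klScale klE0 j ^ 2 / klE0) :
    FrameOK R U (nScales β) μ (fsub (klFrameProjG L μ K) (klTwoLegPolyG L M β U μ K n)) ∧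
    (∀ j ≤ n, RenormalisedAtF L M β U μ (fsub (klFrameProjG L μ K) (klTwoLegPolyG L M β U μ K n)) R j) ∧
    (∀ j ≤ n, ∀ q : Fin 2 → ℝ,
      |(fsub (klFrameProjG L μ K) (klTwoLegPolyG L M β U μ K n)).eval q +
          ∑ i ∈ range (j + 1), (klTwoLegPieceG L M β U μ (fsub (klFrameProjG L μ K) (klTwoLegPolyG L M β U μ K n)) i).eval q| ≤
        ∑ i ∈ Ico (j + 1) (n + 1), twoLegBar G Q U 0 i + 4 / 3 * (G.SL + Q.SL * |U|) * |U| * δ) := by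
  set K' := fsub (klFrameProjG L μ K) (klTwoLegPolyG L M β U μ K n) with hK'def
  set qq : ℝ := 4 / 3 * (G.SL + Q.SL * |U|) * |U| with hqq
  have hK' : FrameOK R U (nScales β) μ K' := ct_frameOK_counterIter hG hQ hμ hR blk hroomA hroomB h0 h1 h2 hK hn hren
  -- the frame distance of the step
  have hdist : frameDist K K' ≤ δ := by
    refine ciSup_le fun p => ?_
    rw [← partialSum_eq_sub_counterIter]
    exact hδ p
  have hlip0 : ∀ i, 0 ≤ lipBar G Q U i := by
    intro i
    have hSL : 0 ≤ G.SL := hG.2.2.2.2.2.2.2.2.2.2.2.2.2.2.2.2.2.2.2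
    have hSL' : 0 ≤ Q.SL := hQ.2.2.2.2.2.2.1
    rw [ct_lipBar_eq]; positivity
  -- strong induction on the scale `j ≤ n`
  have main : ∀ j, j ≤ n →
      (∀ q : Fin 2 → ℝ, |K'.eval q + ∑ i ∈ range (j + 1), (klTwoLegPieceG L M β U μ K' i).eval q| ≤
        ∑ i ∈ Ico (j + 1) (n + 1), twoLegBar G Q U 0 i + qq * δ) ∧
      RenormalisedAtF L M β U μ K' R j := by
    intro j
    induction j using Nat.strong_induction_on with
    | _ j ih =>
      intro hj
      -- the history of `K'` below `j`
      have hrenK' : ∀ j' < j, RenormalisedAtF L M β U μ K' R j' := fun j' hj' => (ih j' hj' (le_of_lt (lt_of_lt_of_le hj' hj))).2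
      have hhist : ∀ j' < j, histV10 L M G P Q R β U μ K' j' := by
        intro j' hj'
        have hb := blk K' hK' j' (le_of_lt (lt_of_lt_of_le (lt_of_lt_of_le hj' hj) hn)) fun i hi => hrenK' i (hi.trans hj')
        exact ⟨hb.2.2, hrenK' j' hj', hb.1⟩
      -- the bound on `S_j(K')`
      have hbound : ∀ q : Fin 2 → ℝ, |K'.eval q + ∑ i ∈ range (j + 1), (klTwoLegPieceG L M β U μ K' i).eval q| ≤
          ∑ i ∈ Ico (j + 1) (n + 1), twoLegBar G Q U 0 i + qq * δ := by
        intro q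
        have hsplit := Finset.sum_range_add_sum_Ico (fun i => (klTwoLegPieceG L M β U μ K i).eval q) (Nat.succ_le_succ hj)
        have hK'q : K'.eval q = -∑ i ∈ range (n + 1), (klTwoLegPieceG L M β U μ K i).eval q := eval_counterImage L M β U μ K n q
        have hident : K'.eval q + ∑ i ∈ range (j + 1), (klTwoLegPieceG L M β U μ K' i).eval q =
            ∑ i ∈ range (j + 1), ((klTwoLegPieceG L M β U μ K' i).eval q - (klTwoLegPieceG L M β U μ K i).eval q) -
              ∑ i ∈ Ico (j + 1) (n + 1), (klTwoLegPieceG L M β U μ K i).eval q := by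
          rw [hK'q, ← hsplit, sum_sub_distrib]; ring
        rw [hident]
        -- Lipschitz part
        have hlipsum : |∑ i ∈ range (j + 1), ((klTwoLegPieceG L M β U μ K' i).eval q - (klTwoLegPieceG L M β U μ K i).eval q)| ≤
            qq * δ := by
          refine (abs_sum_le_sum_abs _ _).trans ?_
          have hterm : ∀ i ∈ range (j + 1),
              |(klTwoLegPieceG L M β U μ K' i).eval q - (klTwoLegPieceG L M β U μ K i).eval q| ≤ lipBar G Q U i * δ := by
            intro i hi
            have hij : i ≤ j := Nat.lt_succ_iff.mp (mem_range.mp hi)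
            have hin : i ≤ nScales β := (hij.trans hj).trans hn
            have hlipi := ((blk K hK i hin fun j' hj' => hren j' (lt_of_lt_of_le hj' (hij.trans hj))).2.1.1).2.2.1
            have h := hlipi K' hK' (fun j' hj' => hhist j' (lt_of_lt_of_le hj' hij)) q
            rw [abs_sub_comm] at h
            exact h.trans (mul_le_mul_of_nonneg_left hdist (hlip0 i))
          refine (sum_le_sum hterm).trans ?_
          rw [← sum_mul]
          exact mul_le_mul_of_nonneg_right (ct_sum_lipBar_le hG hQ U (j + 1)) hδ0
        -- tail part
        have htailsum : |∑ i ∈ Ico (j + 1) (n + 1), (klTwoLegPieceG L M β U μ K i).eval q| ≤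
            ∑ i ∈ Ico (j + 1) (n + 1), twoLegBar G Q U 0 i := by
          refine (abs_sum_le_sum_abs _ _).trans (sum_le_sum fun i hi => ?_)
          have hin : i ≤ n := Nat.lt_succ_iff.mp (mem_Ico.mp hi).2
          exact abs_eval_piece_le_of_block blk hK (hin.trans hn) (fun j' hj' => hren j' (lt_of_lt_of_le hj' hin)) q
        calc |∑ i ∈ range (j + 1), ((klTwoLegPieceG L M β U μ K' i).eval q - (klTwoLegPieceG L M β U μ K i).eval q) -
              ∑ i ∈ Ico (j + 1) (n + 1), (klTwoLegPieceG L M β U μ K i).eval q|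
            ≤ |∑ i ∈ range (j + 1), ((klTwoLegPieceG L M β U μ K' i).eval q - (klTwoLegPieceG L M β U μ K i).eval q)| +
              |∑ i ∈ Ico (j + 1) (n + 1), (klTwoLegPieceG L M β U μ K i).eval q| := abs_sub _ _
          _ ≤ qq * δ + ∑ i ∈ Ico (j + 1) (n + 1), twoLegBar G Q U 0 i := add_le_add hlipsum htailsum
          _ = _ := by ring
      refine ⟨hbound, ?_⟩
      -- renormalisation at `j` by the reading hypothesis
      intro θ
      have h := hread K' hK' j (hj.trans hn) hrenK' _ hbound θ
      have hf := hfeas j hj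
      show |klLocalPart L M β U μ K' j θ| ≤ R.cr * |U| * klScale klE0 j ^ 2 / klE0
      rw [hcr]
      linarith
  exact ⟨hK', fun j hj => (main j hj).2, fun j hj => (main j hj).1⟩

/-- **LEVEL-UP**: a frame renormalised at every `j ≤ n` with `sup|S_n(K)| ≤ e` has `sup|S_{n+1}(K)| ≤ e + twoLegBar 0 (n+1)` (one more
piece, its size from the block) — the pre-step data at level `n + 1`. -/
theorem ct_levelUp
    (blk : ∀ K : TrigPolyC4v, FrameOK R U (nScales β) μ K → ∀ n : ℕ, n ≤ nScales β →
      (∀ j < n, RenormalisedAtF L M β U μ K R j) →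
        EngineBoundsAtV7S L M G P Q β U μ K n ∧ TwoLegStepV11 L M G P Q R β U μ K n ∧ BetaSplitAtS2 L M G P Q β U μ K n) {K : TrigPolyC4v} (hK : FrameOK R U (nScales β) μ K) {n : ℕ} (hn : n + 1 ≤ nScales β)
    (hren : ∀ j ≤ n, RenormalisedAtF L M β U μ K R j) {e : ℝ}
    (hS : ∀ q : Fin 2 → ℝ, |K.eval q + ∑ i ∈ range (n + 1), (klTwoLegPieceG L M β U μ K i).eval q| ≤ e) :
    (∀ j < n + 1, RenormalisedAtF L M β U μ K R j) ∧
    ∀ q : Fin 2 → ℝ, |K.eval q + ∑ i ∈ range (n + 1 + 1), (klTwoLegPieceG L M β U μ K i).eval q| ≤ e + twoLegBar G Q U 0 (n + 1) := by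
  have hren' : ∀ j < n + 1, RenormalisedAtF L M β U μ K R j := fun j hj => hren j (Nat.lt_succ_iff.mp hj)
  refine ⟨hren', fun q => ?_⟩
  rw [sum_range_succ, ← add_assoc]
  refine (abs_add_le _ _).trans (add_le_add (hS q) ?_)
  exact abs_eval_piece_le_of_block blk hK hn hren' q

end Step

/-! ## §4 The induction over the levels and the one-volume construction -/

section Main

variable {L M : ℕ} [NeZero L] [NeZero M] {G : GeoConsts} {P : SplitConsts} {Q : EngConsts} {β U μ : ℝ} {R : RenConsts}
  (wig : ℕ → ℝ)

/-- **The numeric heart**: with `Q.S′ 0·|U| ≤ 1/10`, `q ≤ 1/1000` and `wig j ≤ |U|·16^{-j}/256`, for `j ≤ n ≤ N`: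
`T̄_{j,n} + q·(2·twoLegBar 0 n) + wig j ≤ ½·ctCr G·|U|·Λ_j²/e₀` (so both the step feasibility — full tolerance — and the final half
tolerance hold). -/
theorem ct_budget (hG : G.WF) (hQ : Q.WF)
    (hwig : ∀ n ≤ nScales β, wig n ≤ |U| * ((16 : ℝ) ^ n)⁻¹ / 256)
    (hS0' : Q.S' 0 * |U| ≤ 1 / 10) (hq : 4 / 3 * (G.SL + Q.SL * |U|) * |U| ≤ 1 / 1000) {j n : ℕ} (hjn : j ≤ n) (hn : n ≤ nScales β) :
    ∑ i ∈ Ico (j + 1) (n + 1), twoLegBar G Q U 0 i + 4 / 3 * (G.SL + Q.SL * |U|) * |U| * (2 * twoLegBar G Q U 0 n) + wig j ≤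
      ctCr G * |U| * klScale klE0 j ^ 2 / klE0 / 2 := by
  have hS : 0 ≤ G.S 0 := hG.2.2.2.2.2.2.2.2.2.2.2.2.2.2.2.2.2.1 0
  have hS' : 0 ≤ Q.S' 0 := hQ.2.2.2.2.1 0
  have hSL : 0 ≤ G.SL := hG.2.2.2.2.2.2.2.2.2.2.2.2.2.2.2.2.2.2.2
  have hSL' : 0 ≤ Q.SL := hQ.2.2.2.2.2.2.1
  have htail := ct_sum_Ico_twoLegBar_zero_le hG hQ U j n
  have hmono := ct_twoLegBar_zero_anti hG hQ U hjn
  have hw := hwig j (hjn.trans hn)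
  have htlb : twoLegBar G Q U 0 j = (G.S 0 + Q.S' 0 * |U|) * |U| * ((16 : ℝ) ^ j)⁻¹ := ct_twoLegBar_zero_eq G Q U j
  have htol : ctCr G * |U| * klScale klE0 j ^ 2 / klE0 / 2 = (5 * G.S 0 + 1) / 64 * (|U| * ((16 : ℝ) ^ j)⁻¹) := by
    rw [ct_tol_eq]; unfold ctCr; ring
  rw [htol]
  set x : ℝ := |U| * ((16 : ℝ) ^ j)⁻¹ with hx
  have hx0 : 0 ≤ x := by positivity
  have htlb' : twoLegBar G Q U 0 j = (G.S 0 + Q.S' 0 * |U|) * x := by rw [htlb, hx]; ring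
  have hq0 : 0 ≤ 4 / 3 * (G.SL + Q.SL * |U|) * |U| := by positivity
  have htlbn0 : 0 ≤ twoLegBar G Q U 0 n := by rw [ct_twoLegBar_zero_eq]; positivity
  -- everything in units of `x`
  have h1 : ∑ i ∈ Ico (j + 1) (n + 1), twoLegBar G Q U 0 i ≤ (G.S 0 + Q.S' 0 * |U|) * x / 15 := by rw [← htlb']; exact htail
  have h2 : 4 / 3 * (G.SL + Q.SL * |U|) * |U| * (2 * twoLegBar G Q U 0 n) ≤ 1 / 1000 * (2 * ((G.S 0 + Q.S' 0 * |U|) * x)) := by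
    rw [← htlb']
    exact mul_le_mul hq (by linarith) (by positivity) (by norm_num)
  have h3 : wig j ≤ x / 256 := by
    have : |U| * ((16 : ℝ) ^ j)⁻¹ / 256 = x / 256 := by rw [hx]
    linarith [hw, this.le, this.ge]
  have hSx : Q.S' 0 * |U| * x ≤ 1 / 10 * x := mul_le_mul_of_nonneg_right hS0' hx0
  have hSx0 : 0 ≤ G.S 0 * x := mul_nonneg hS hx0
  linarith

/-- **The induction over the levels** (one Picard step per level): for every `n ≤ N` there is an admissible frame, renormalised at every
`j ≤ n`, with `sup|S_j(K)| ≤ T̄_{j,n} + q·(2·twoLegBar 0 n)` for `j ≤ n`. -/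
theorem ct_exists_post (hG : G.WF) (hQ : Q.WF) (hμ : μ ∈ klWindowC) (hR : ∀ j, 0 ≤ R.Gfr j) (hcr : R.cr = ctCr G)
    (blk : ∀ K : TrigPolyC4v, FrameOK R U (nScales β) μ K → ∀ n : ℕ, n ≤ nScales β →
      (∀ j < n, RenormalisedAtF L M β U μ K R j) →
        EngineBoundsAtV7S L M G P Q β U μ K n ∧ TwoLegStepV11 L M G P Q R β U μ K n ∧ BetaSplitAtS2 L M G P Q β U μ K n)
    (hread : ∀ K : TrigPolyC4v, FrameOK R U (nScales β) μ K → ∀ n : ℕ, n ≤ nScales β →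
      (∀ j < n, RenormalisedAtF L M β U μ K R j) → ∀ B : ℝ,
        (∀ q : Fin 2 → ℝ, |K.eval q + ∑ i ∈ range (n + 1), (klTwoLegPieceG L M β U μ K i).eval q| ≤ B) →
          ∀ θ : ℝ, |klLocalPart L M β U μ K n θ| ≤ B + wig n)
    (hwig : ∀ n ≤ nScales β, wig n ≤ |U| * ((16 : ℝ) ^ n)⁻¹ / 256)
    (hS0' : Q.S' 0 * |U| ≤ 1 / 10) (hq : 4 / 3 * (G.SL + Q.SL * |U|) * |U| ≤ 1 / 1000)
    (hroomA : ∀ j ≤ 4, 2 * (G.S j + Q.S' j * |U|) ≤ R.Gfr j) (hroomB : ∀ n : ℕ, ∑ i ∈ range (n + 1), msBar G Q U i ≤ 1 / 2)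
    (h0 : ∑ m ∈ range (nScales β + 1), R.Gfr 0 * uPow 0 U * (4 : ℝ) ^ (((0 : ℤ) - 2) * m) ≤ 3 / 80)
    (h1 : ∑ m ∈ range (nScales β + 1), R.Gfr 1 * uPow 1 U * (4 : ℝ) ^ (((1 : ℤ) - 2) * m) ≤ 1 / 2000)
    (h2 : ∑ m ∈ range (nScales β + 1), ∑ j ∈ range 3, R.Gfr j * uPow j U * (4 : ℝ) ^ (((j : ℤ) - 2) * m) ≤ 1 / 100) (n : ℕ) (hn : n ≤ nScales β) :
    ∃ K : TrigPolyC4v, FrameOK R U (nScales β) μ K ∧ (∀ j ≤ n, RenormalisedAtF L M β U μ K R j) ∧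
      ∀ j ≤ n, ∀ q : Fin 2 → ℝ, |K.eval q + ∑ i ∈ range (j + 1), (klTwoLegPieceG L M β U μ K i).eval q| ≤
        ∑ i ∈ Ico (j + 1) (n + 1), twoLegBar G Q U 0 i + 4 / 3 * (G.SL + Q.SL * |U|) * |U| * (2 * twoLegBar G Q U 0 n) := by
  have htlb0 : ∀ i, 0 ≤ twoLegBar G Q U 0 i := fun i => twoLegBar_nonneg' hG hQ U 0 i
  have hqq0 : 0 ≤ 4 / 3 * (G.SL + Q.SL * |U|) * |U| := by
    have hSL : 0 ≤ G.SL := hG.2.2.2.2.2.2.2.2.2.2.2.2.2.2.2.2.2.2.2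
    have hSL' : 0 ≤ Q.SL := hQ.2.2.2.2.2.2.1
    positivity
  -- feasibility of a step at level `m` with pre-step bound `2·twoLegBar 0 m`
  have hfeas : ∀ m ≤ nScales β, ∀ j ≤ m,
      ∑ i ∈ Ico (j + 1) (m + 1), twoLegBar G Q U 0 i + 4 / 3 * (G.SL + Q.SL * |U|) * |U| * (2 * twoLegBar G Q U 0 m) + wig j ≤
        ctCr G * |U| * klScale klE0 j ^ 2 / klE0 := by
    intro m hm j hj
    have h := ct_budget wig hG hQ hwig hS0' hq hj hm
    have htolpos : 0 ≤ ctCr G * |U| * klScale klE0 j ^ 2 / klE0 := by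
      have hS : 0 ≤ G.S 0 := hG.2.2.2.2.2.2.2.2.2.2.2.2.2.2.2.2.2.1 0
      have : 0 ≤ ctCr G := by unfold ctCr; positivity
      have he0 : (0 : ℝ) < klE0 := by norm_num [klE0]
      positivity
    linarith
  induction n with
  | zero =>
    -- the zero frame is admissible; one step at level 0
    have hzero : FrameOK R U (nScales β) μ (0 : TrigPolyC4v) := by
      refine frameOK_of_pieces hR hμ (K := 0) (Kp := fun _ => 0) (N := nScales β) (fun p => by simp [eval_fsub]) ?_ h0 h1 h2
      intro m _ j _ q
      rw [evalM_zero_eq, iteratedFDeriv_fun_zero]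
      simp only [Pi.zero_apply, norm_zero]
      exact mul_nonneg (mul_nonneg (hR j) (uPow_nonneg j U)) (zpow_nonneg (by norm_num) _)
    have hpre : ∀ q : Fin 2 → ℝ, |(0 : TrigPolyC4v).eval q + ∑ i ∈ range (0 + 1), (klTwoLegPieceG L M β U μ 0 i).eval q| ≤
        2 * twoLegBar G Q U 0 0 := by
      intro q
      rw [TrigPolyC4v.eval_zero, zero_add, zero_add, sum_range_one]
      have := abs_eval_piece_le_of_block blk hzero (i := 0) (Nat.zero_le _) (fun j hj => absurd hj (Nat.not_lt_zero j)) q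
      linarith [htlb0 0]
    obtain ⟨hK', hren', hS'⟩ := ct_step wig hG hQ hμ hR hcr blk hread hroomA hroomB h0 h1 h2 hzero (Nat.zero_le _)
      (fun j hj => absurd hj (Nat.not_lt_zero j)) (by linarith [htlb0 0]) hpre (hfeas 0 hn)
    exact ⟨_, hK', hren', hS'⟩
  | succ n ih =>
    obtain ⟨K, hK, hren, hS⟩ := ih (Nat.le_of_succ_le hn)
    -- level-up: pre-step data at level `n + 1`
    have hSn : ∀ q : Fin 2 → ℝ, |K.eval q + ∑ i ∈ range (n + 1), (klTwoLegPieceG L M β U μ K i).eval q| ≤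
        4 / 3 * (G.SL + Q.SL * |U|) * |U| * (2 * twoLegBar G Q U 0 n) := by
      intro q
      have h := hS n le_rfl q
      rwa [Finset.Ico_self, sum_empty, zero_add] at h
    obtain ⟨hren', hpre⟩ := ct_levelUp blk hK hn hren hSn
    -- the pre-step bound is at most `2·twoLegBar 0 (n+1)`
    have hpre' : ∀ q : Fin 2 → ℝ, |K.eval q + ∑ i ∈ range (n + 1 + 1), (klTwoLegPieceG L M β U μ K i).eval q| ≤
        2 * twoLegBar G Q U 0 (n + 1) := by
      intro q
      refine (hpre q).trans ?_
      have h16 : twoLegBar G Q U 0 n = 16 * twoLegBar G Q U 0 (n + 1) := by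
        simp only [ct_twoLegBar_zero_eq, pow_succ, mul_inv]
        ring
      rw [h16]
      nlinarith [htlb0 (n + 1)]
    obtain ⟨hK', hren'', hS'⟩ := ct_step wig hG hQ hμ hR hcr blk hread hroomA hroomB h0 h1 h2 hK hn hren' (by linarith [htlb0 (n + 1)]) hpre'
      (hfeas (n + 1) hn)
    exact ⟨_, hK', hren'', hS'⟩

/-- **THE ONE-VOLUME CONSTRUCTION GIVEN THE READING** (child Counterterm's analytic content at one volume): at a volume carrying the V11
block and the reading inequality with slack `wig n ≤ |U|16^{-n}/256`, under the numeric side conditions on `U` and the three allowance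
sums, there is an ADMISSIBLE frame whose scale-`n` local part is within HALF the quadratic tolerance at every scale `n ≤ nScales β` and
every real angle. -/
theorem ct_oneVolume_of_reading (hG : G.WF) (hQ : Q.WF) (hμ : μ ∈ klWindowC) (hR : ∀ j, 0 ≤ R.Gfr j) (hcr : R.cr = ctCr G)
    (blk : ∀ K : TrigPolyC4v, FrameOK R U (nScales β) μ K → ∀ n : ℕ, n ≤ nScales β →
      (∀ j < n, RenormalisedAtF L M β U μ K R j) →
        EngineBoundsAtV7S L M G P Q β U μ K n ∧ TwoLegStepV11 L M G P Q R β U μ K n ∧ BetaSplitAtS2 L M G P Q β U μ K n)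
    (hread : ∀ K : TrigPolyC4v, FrameOK R U (nScales β) μ K → ∀ n : ℕ, n ≤ nScales β →
      (∀ j < n, RenormalisedAtF L M β U μ K R j) → ∀ B : ℝ,
        (∀ q : Fin 2 → ℝ, |K.eval q + ∑ i ∈ range (n + 1), (klTwoLegPieceG L M β U μ K i).eval q| ≤ B) →
          ∀ θ : ℝ, |klLocalPart L M β U μ K n θ| ≤ B + wig n)
    (hwig : ∀ n ≤ nScales β, wig n ≤ |U| * ((16 : ℝ) ^ n)⁻¹ / 256)
    (hS0' : Q.S' 0 * |U| ≤ 1 / 10) (hq : 4 / 3 * (G.SL + Q.SL * |U|) * |U| ≤ 1 / 1000)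
    (hroomA : ∀ j ≤ 4, 2 * (G.S j + Q.S' j * |U|) ≤ R.Gfr j) (hroomB : ∀ n : ℕ, ∑ i ∈ range (n + 1), msBar G Q U i ≤ 1 / 2)
    (h0 : ∑ m ∈ range (nScales β + 1), R.Gfr 0 * uPow 0 U * (4 : ℝ) ^ (((0 : ℤ) - 2) * m) ≤ 3 / 80)
    (h1 : ∑ m ∈ range (nScales β + 1), R.Gfr 1 * uPow 1 U * (4 : ℝ) ^ (((1 : ℤ) - 2) * m) ≤ 1 / 2000)
    (h2 : ∑ m ∈ range (nScales β + 1), ∑ j ∈ range 3, R.Gfr j * uPow j U * (4 : ℝ) ^ (((j : ℤ) - 2) * m) ≤ 1 / 100) :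
    ∃ K : TrigPolyC4v, FrameOK R U (nScales β) μ K ∧
      ∀ n ≤ nScales β, ∀ θ : ℝ, |klLocalPart L M β U μ K n θ| ≤ ctCr G * |U| * klScale klE0 n ^ 2 / klE0 / 2 := by
  obtain ⟨K, hK, hren, hS⟩ := ct_exists_post wig hG hQ hμ hR hcr blk hread hwig hS0' hq hroomA hroomB h0 h1 h2 (nScales β) le_rfl
  refine ⟨K, hK, fun n hn θ => ?_⟩
  have h := hread K hK n hn (fun j hj => hren j (le_of_lt (lt_of_lt_of_le hj hn))) _ (hS n hn) θ
  exact h.trans (by have := ct_budget wig hG hQ hwig hS0' hq hn le_rfl; linarith)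

end Main

end Summit.HubbardSuperconductivity.HubbardSuperconductivity.Theorems.KLRegimeSplit

end
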